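import Summits.BirchSwinnertonDyer.BirchSwinnertonDyer.Theses.SchneiderFreeAdditiveX3
import Summits.BirchSwinnertonDyer.BirchSwinnertonDyer.Theorems.SchneiderFreeAdditiveX3PotMultBranchIMCReductions
import Summits.BirchSwinnertonDyer.Rank1Residual.Supersingular.X6RankOneGoodHalvesPointwise
import HarnessLib

/-!
# Route `SchneiderFreeAdditiveX3`, crux `GordTwoBranchIMC` (item stmt-BirchSwinnertonDyer-19177):
# the Manin-robust RECEPTACLE — halves ⟹ the socket `AdditiveIMCLowerBDPOnTreeLeAt … (v_p c) P`

Cell `bsd-schneider-ideate`, seat `bsd-schneider-door-c3` (prover). HONEST FRAMING: pure algebra and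
propositional bookkeeping; NOTHING is asserted about elliptic curves. BSD is not proved by any of this;
the crux `GordTwoBranchIMC` (Keller–Yin arXiv:2410.23241 Thm. 3.5.1 ∘ BDP/Liu–Zhang–Zhang value at 𝟙,
PRE) stays OPEN; this file is `--supports` material for it (and serves the sibling crux
`PotMultBranchIMC`, item 19176, verbatim: same socket on the (M) cell).

## What is kernel-checked here

The rev-3 socket of the route (`Theorems/SchneiderFreeSocketsV2.lean`) is, pointwise,
`AdditiveIMCLowerBDPOnTreeLeAt p κ 𝔭 γ ι s P := ∃ n, XAc.HasCharValuationAt (E_K) p κ 𝔭 ∅ γ n ∧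
2·ord_p log_{ω_E} P ≤ n + 2s`, taken at the Manin slack `s = v_p(c)`, `c = Dt.c` the constant of the
parametrisation datum (`c·Λ_f ⊆ Λ_E`, so `log_{ω_E} P_K = c · log_{ω_f} P_K`). This file proves the
additive-prime twin of team x11b3's receptacle `X11b.Halves.imcLowerWaldspurgerOnTreeAt_of_value_of_dvd`:

* §1 `two_mul_valuation_le_of_hasValueAt_sq` (every `p`; the integral-cofactor form of
  `Supersingular.two_mul_valuation_le_of_mem_span`, whose `two_mul_le_of_zpow_le` is reused): if
  `f ∈ Λ = ℤ_p⟦T⟧` has `f(0) ≠ 0`, its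
  image in `Λ_{R₀} = R₀⟦T⟧` lies in `(L)`, and `L(0) = u·y²` for an INTEGRAL cofactor `u ∈ R₀` (a unit
  is not needed for a LOWER bound) and `y ∈ ℚ_p`, then `y ≠ 0` and `2·ord_p y ≤ ord_p f(0)` — by norms
  in `ℂ_p` (`‖G(0)‖ ≤ 1`, `‖u‖ ≤ 1`); no Euler-type factor is spent (at an ADDITIVE prime `a_p(E) = 0`
  and `ε_p = 0`, so Castella's factor `(1 − a_p p⁻¹ φ(𝔭) + ε_p φ(𝔭)²)` is `1`).
* §2 **`additiveIMCLowerBDPOnTreeLeAt_of_value_of_dvd`** (pointwise, every `p`, every embedding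
  `ι : K → ℚ_p`, every integer `c`): CTL₀ (`HasCharValuationAt … n`) ∧ the one-sided divisibility
  `Ch_Λ(X_ac)·R₀⟦T⟧ ⊆ (L)` ∧ the value shape `L(0) = u·(log_{ω_E} P / c)²` (`u ∈ R₀`) ⟹
  `AdditiveIMCLowerBDPOnTreeLeAt p κ 𝔭 γ ι (v_p c) P` with the SAME `n`; `log_{ω_E} P ≠ 0` and
  `c ≠ 0` come out, they are not put in. This is exactly the shape in which "branch main conjecture ⊇
  for an `L ∈ Λ^{ur}`" (Keller–Yin 2410.23241 Thm. 3.5.1: `Char_Λ(𝔛)Λ^{ur} = (𝓛_ε)`) composed with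
  "BDP/`p`-adic Waldspurger value at 𝟙, intrinsic to the newform" (`𝓛_ε(𝟙) ≐ log_{ω_f}(P_K)² =
  (log_{ω_E} P_K / c)²`) delivers the socket — for WHATEVER correctly normalised `L` the literature
  supplies (no interpolation predicate is fixed here: the normalisation of the interpolation formula at
  `p² ∣ N` is the open "interpolation matching" step of the route, not decided in this file).
* §2 `divisibilityLe_of_value_of_dvd` (pointwise): the same halves give the registered
  DIVISIBILITY STUB shape `∀ n, HasCharValuationAt … n → 2·ord_p log_{ω_E} P ≤ n + 2·v_p(c)` (by
  `HasCharValuationAt.unique`); `additiveIMCLowerBDPOnTreeLeAt_mono` (monotone in the slack);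
  `additiveIMCLowerBDPOnTreeLeAt_of_control_of_bound` (control ∧ bound ⟹ socket, reusing seat
  door-c2's `exists_hasCharValuationAt_of_control`).
* §3 class level, on the REGISTERED BC3 skeleton of item 19177 (planner g7, sha e612942f…, stubs
  `stub_charTorsion`, `stub_divisibilityLe`): `gordTwo_stub_charTorsion_of_anticycControlAdditive`
  — `stub_charTorsion` (signature verbatim) FOLLOWS from the sibling crux `AnticycControlAdditive`
  (item 19178; `SubGordTwo ⊆ SubSemistableTwist`; the (M) twin is door-c2's
  `stub_charTorsion_of_anticycControlAdditive`); `gordTwoBranchIMC_of_anticycControlAdditive_of_divisibilityLe`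
  — the crux BY NAME from crux 19178 and `stub_divisibilityLe` (verbatim, as a hypothesis);
  `gordTwo_stub_divisibilityLe_of_halves` — `stub_divisibilityLe` (verbatim) from a supply of halves
  `(L, u)` at every datum/frame. Net: modulo crux r4, crux r3 IS `stub_divisibilityLe`, and
  `stub_divisibilityLe` IS "branch IMC ⊇ + value at 𝟙" for any integral `L`.

## What this does NOT do
No `p`-adic `L`-function is constructed, no divisibility or value formula is claimed; `GordTwoBranchIMC`,
`PotMultBranchIMC`, `AnticycControlAdditive` stay OPEN. Nothing is booked; no label changes.

References: Keller–Yin, arXiv:2410.23241 Thm. 3.4.3, Prop. 3.4.4, Thm. 3.5.1 (pp. 19–20: `𝓛_ε :=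
𝓛_p(f̃)(χ_ε)`, "`𝓛_p(f̃, χ_ε(·)) = 𝓛_p(f, ·)`", `Char_Λ(𝔛)Λ^{ur} = (𝓛_ε)`); Liu–Zhang–Zhang, Duke Math.
J. 167 (2018) Thm. 1.8 (arXiv:1511.08172 p. 5); Castella, Camb. J. Math. 6 (2018) Thm. 2.3, §5 (5.1)
(arXiv:1704.06608 pp. 5, 12); Jetchev–Skinner–Wan, Camb. J. Math. 5 (2017) §7.4.1 (arXiv:1512.06894
p. 30).
-/

noncomputable section

open scoped Classical

open WeierstrassCurve NumberField IsDedekindDomain Field PowerSeries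
  Literature.NumberTheory.EllipticCurves
  Literature.NumberTheory.EllipticCurves.ModularForms
  Literature.NumberTheory.EllipticCurves.GreenbergSelmer
  Literature.NumberTheory.EllipticCurves.Rank1Residual
  Literature.NumberTheory.EllipticCurves.Rank1Residual.Typed
  Summit.BirchSwinnertonDyer.Rank1Residual
  Summit.BirchSwinnertonDyer.Rank1Residual.X11b
  Summit.BirchSwinnertonDyer.Rank1Residual.X11b.AcSelmer
  Summit.BirchSwinnertonDyer.Rank1Residual.X11b.Halves
  Summit.BirchSwinnertonDyer.Rank1Residual.X11b.CongruenceLimit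
  Summit.BirchSwinnertonDyer.BirchSwinnertonDyer.Theses.SchneiderFreeAdditiveX3

-- D-0017 layout: summit = sub-problem, so `Summit.BirchSwinnertonDyer.BirchSwinnertonDyer.…` is the
-- mandated namespace (same option as the route's sockets files).
set_option linter.dupNamespace false

namespace Summit.BirchSwinnertonDyer.BirchSwinnertonDyer.Theorems.SchneiderFree

/-! ## §1 Norm algebra in `ℂ_p` (every prime `p`) -/

section Receptacle

variable (p : ℕ) [Fact p.Prime]

/-- **The norm algebra of the additive receptacle (every `p`).** If `f ∈ Λ = ℤ_p⟦T⟧` has non-zero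
constant term, its image in `Λ_{R₀} = R₀⟦T⟧` lies in `(L)`, and `L(0) = u·y²` with an INTEGRAL cofactor
`u ∈ R₀` and `y ∈ ℚ_p`, then `y ≠ 0` and `2·ord_p y ≤ ord_p f(0)`:
`‖f(0)‖ = ‖G(0)‖·‖L(0)‖ ≤ ‖L(0)‖ = ‖u‖·‖y‖² ≤ ‖y‖²`. The `y`-general, unit-free form of
`X11b.Halves.two_mul_sub_one_le_valuation` (no Euler-type factor is spent). [folklore] -/
theorem two_mul_valuation_le_of_hasValueAt_sq {f : IwasawaAlgebra p} (hf0 : constantCoeff f ≠ 0)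
    {L : UnrSeries p} (hfL : PowerSeries.map (toUnr p) f ∈ Ideal.span {L})
    (u : unrIntegers p) {y : ℚ_[p]}
    (hL : L.HasValueAt 0 (((u : unrIntegers p) : ℂ_[p]) * (algebraMap ℚ_[p] ℂ_[p] y) ^ 2)) :
    y ≠ 0 ∧ 2 * y.valuation ≤ ((constantCoeff f).valuation : ℤ) := by
  -- `L(0)` is the constant term
  have hL0 : ((u : unrIntegers p) : ℂ_[p]) * (algebraMap ℚ_[p] ℂ_[p] y) ^ 2 =
      ((constantCoeff L : unrIntegers p) : ℂ_[p]) :=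
    UnrSeries.eq_constantCoeff_of_hasValueAt_zero hL
  -- `f ↦ G·L`
  obtain ⟨G, hG⟩ := Ideal.mem_span_singleton'.mp hfL
  have hfac : algebraMap ℚ_[p] ℂ_[p] ((constantCoeff f : ℤ_[p]) : ℚ_[p]) =
      ((constantCoeff G : unrIntegers p) : ℂ_[p]) * ((constantCoeff L : unrIntegers p) : ℂ_[p]) := by
    rw [← coe_toUnr, ← constantCoeff_map_apply (toUnr p) f, ← hG, map_mul, Subring.coe_mul]
  -- norms
  have hnormf : ‖((constantCoeff f : ℤ_[p]) : ℚ_[p])‖ ≤ ‖y‖ ^ 2 := by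
    calc ‖((constantCoeff f : ℤ_[p]) : ℚ_[p])‖
        = ‖algebraMap ℚ_[p] ℂ_[p] ((constantCoeff f : ℤ_[p]) : ℚ_[p])‖ :=
          (norm_algebraMap' ℂ_[p] _).symm
      _ = ‖((constantCoeff G : unrIntegers p) : ℂ_[p])‖ *
            ‖((constantCoeff L : unrIntegers p) : ℂ_[p])‖ := by rw [hfac, norm_mul]
      _ ≤ 1 * ‖((constantCoeff L : unrIntegers p) : ℂ_[p])‖ :=
          mul_le_mul_of_nonneg_right (norm_coe_unrIntegers_le_one p _) (norm_nonneg _)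
      _ = ‖((u : unrIntegers p) : ℂ_[p])‖ * ‖algebraMap ℚ_[p] ℂ_[p] y‖ ^ 2 := by
          rw [one_mul, ← hL0, norm_mul, norm_pow]
      _ ≤ 1 * ‖algebraMap ℚ_[p] ℂ_[p] y‖ ^ 2 :=
          mul_le_mul_of_nonneg_right (norm_coe_unrIntegers_le_one p _) (by positivity)
      _ = ‖y‖ ^ 2 := by rw [one_mul, norm_algebraMap']
  -- `y ≠ 0`
  have hy0 : y ≠ 0 := by
    intro hy
    rw [hy, norm_zero, zero_pow two_ne_zero] at hnormf
    have h0 : ((constantCoeff f : ℤ_[p]) : ℚ_[p]) = 0 :=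
      norm_eq_zero.mp (le_antisymm hnormf (norm_nonneg _))
    exact hf0 (PadicInt.coe_eq_zero.mp h0)
  refine ⟨hy0, Supersingular.two_mul_le_of_zpow_le p ?_⟩
  rwa [← PadicInt.norm_def, PadicInt.norm_eq_zpow_neg_valuation hf0,
    Padic.norm_eq_zpow_neg_valuation hy0] at hnormf

/-- `ord_p (y / c) = ord_p y − v_p(c)` for `y ≠ 0` in `ℚ_p` and a non-zero integer `c`
(`v_p(c) = padicValNat p |c|`). [folklore] -/
theorem valuation_div_intCast {y : ℚ_[p]} (hy : y ≠ 0) {c : ℤ} (hc : (c : ℚ_[p]) ≠ 0) :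
    (y / (c : ℚ_[p])).valuation = y.valuation - (padicValNat p c.natAbs : ℤ) := by
  rw [div_eq_mul_inv, Padic.valuation_mul hy (inv_ne_zero hc), Padic.valuation_inv,
    Padic.valuation_intCast]
  simp [padicValInt, sub_eq_add_neg]

end Receptacle

/-! ## §2 The pointwise receptacle of the additive socket (every `p`, every embedding, every `c`) -/

section Pointwise

variable {p : ℕ} [Fact p.Prime] {K : Type} [Field K] [NumberField K]
  {W : WeierstrassCurve ℚ} [W.IsElliptic] [W.IsGloballyMinimal] {κ : ZpExtension K p}
  {𝔭 : HeightOneSpectrum (𝓞 K)} {γ : Field.absoluteGaloisGroup K} [Fact (κ.IsTopGenerator γ)]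
  {ι : K →+* ℚ_[p]} {P : (W.baseChange K).toAffine.Point}

/-- **HALVES ⟹ the Manin-robust socket, pointwise (every `p`).** CTL₀ (`HasCharValuationAt … n`:
`X_ac^∅(E_K[p^∞])` is `Λ`-torsion with a characteristic generator of non-zero constant term of
valuation `n`) ∧ the ONE-SIDED divisibility `Ch_Λ(X_ac)·R₀⟦T⟧ ⊆ (L)` (the "⊇" half of a branch
main conjecture `Char_Λ(𝔛)Λ^{ur} = (L)`, e.g. Keller–Yin 2410.23241 Thm. 3.5.1 for `L = 𝓛_ε`) ∧ the
value shape at the trivial character `L(0) = u·(log_{ω_E} P / c)²` with an INTEGRAL cofactor `u ∈ R₀`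
(the BDP / `p`-adic Waldspurger value at 𝟙 is `log_{ω_f}(P_K)²` up to units, intrinsic to the newform
`f`, and `log_{ω_E} = c · log_{ω_f}` for a parametrisation datum of constant `c`) ⟹
`AdditiveIMCLowerBDPOnTreeLeAt p κ 𝔭 γ ι (v_p c) P` with the SAME `n`, i.e.
`2·ord_p log_{ω_E} P ≤ n + 2·v_p(c)`. `log_{ω_E} P ≠ 0` and `c ≠ 0` come out; they are not put in.
The additive-prime (Euler shift `0`), Manin-robust twin of
`X11b.Halves.imcLowerWaldspurgerOnTreeAt_of_value_of_dvd`.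
[cite: Castella2018, §5 (5.1)–(5.3) (arXiv:1704.06608 p. 12) (the assembly, as an inequality)]
[cite: JetchevSkinnerWan2017, §7.4.1 (arXiv p. 30)] -/
theorem additiveIMCLowerBDPOnTreeLeAt_of_value_of_dvd {n : ℕ}
    (hn : XAc.HasCharValuationAt (W.baseChange K) p κ 𝔭 ∅ γ n) {L : UnrSeries p}
    (h3 : (XAc.charIdeal (W.baseChange K) p κ 𝔭 ∅ γ).map (PowerSeries.map (toUnr p)) ≤
      Ideal.span {L})
    (u : unrIntegers p) (c : ℤ)
    (h2 : L.HasValueAt 0 (((u : unrIntegers p) : ℂ_[p]) *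
      (algebraMap ℚ_[p] ℂ_[p] (logOmega W p ι P / (c : ℚ_[p]))) ^ 2)) :
    AdditiveIMCLowerBDPOnTreeLeAt p κ 𝔭 γ ι (padicValNat p c.natAbs) P := by
  obtain ⟨htors, f, hf, hf0, hfn⟩ := hn
  have hmem : PowerSeries.map (toUnr p) f ∈ Ideal.span {L} := by
    rw [hf, map_span_singleton_powerSeries] at h3
    exact (Ideal.span_singleton_le_iff_mem _).mp h3
  obtain ⟨hy0, hle⟩ := two_mul_valuation_le_of_hasValueAt_sq p hf0 hmem u h2
  have hx0 : logOmega W p ι P ≠ 0 := by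
    intro h; apply hy0; rw [h, zero_div]
  have hc0 : (c : ℚ_[p]) ≠ 0 := by
    intro h; apply hy0; rw [h, div_zero]
  rw [valuation_div_intCast p hx0 hc0, valuation_logOmega hx0, hfn] at hle
  refine ⟨n, ⟨htors, f, hf, hf0, hfn⟩, ?_⟩
  linarith

/-- **HALVES ⟹ the registered divisibility-stub shape, pointwise.** With the same three inputs as
`additiveIMCLowerBDPOnTreeLeAt_of_value_of_dvd`, EVERY `HasCharValuationAt`-witness `n` satisfies
`2·ord_p log_{ω_E} P ≤ n + 2·v_p(c)` (the witness is unique, `XAc.HasCharValuationAt.unique`). This is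
the pointwise form of the registered stub `stub_divisibilityLe` of items 19176/19177.
[cite: Castella2018, Thm. 2.3 and §5 (5.1) (arXiv:1704.06608 pp. 5, 12)] -/
theorem divisibilityLe_of_value_of_dvd {n : ℕ}
    (hn : XAc.HasCharValuationAt (W.baseChange K) p κ 𝔭 ∅ γ n) {L : UnrSeries p}
    (h3 : (XAc.charIdeal (W.baseChange K) p κ 𝔭 ∅ γ).map (PowerSeries.map (toUnr p)) ≤
      Ideal.span {L})
    (u : unrIntegers p) (c : ℤ)
    (h2 : L.HasValueAt 0 (((u : unrIntegers p) : ℂ_[p]) *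
      (algebraMap ℚ_[p] ℂ_[p] (logOmega W p ι P / (c : ℚ_[p]))) ^ 2)) :
    2 * X11b.padicLogOrd W p ι P ≤ (n : ℤ) + 2 * (padicValNat p c.natAbs : ℤ) := by
  obtain ⟨n', hn', hle⟩ := additiveIMCLowerBDPOnTreeLeAt_of_value_of_dvd hn h3 u c h2
  obtain rfl : n = n' := hn.unique hn'
  exact hle

/-- The socket is monotone in the slack. [folklore] -/
theorem additiveIMCLowerBDPOnTreeLeAt_mono {s s' : ℕ} (hss' : s ≤ s')
    (h : AdditiveIMCLowerBDPOnTreeLeAt p κ 𝔭 γ ι s P) :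
    AdditiveIMCLowerBDPOnTreeLeAt p κ 𝔭 γ ι s' P := by
  obtain ⟨n, hn, hle⟩ := h
  refine ⟨n, hn, ?_⟩
  have : (s : ℤ) ≤ (s' : ℤ) := by exact_mod_cast hss'
  linarith

/-- **The socket from CTL₀-as-control plus a divisibility bound.** If the control identity holds at a
frame and every `HasCharValuationAt`-witness `n` satisfies `2·ord_p log_{ω_E} P ≤ n + 2s`, the socket
holds with slack `s`. (The shape in which the crux's two registered halves — torsion/control and the
divisibility bound — recombine.) [folklore] -/
theorem additiveIMCLowerBDPOnTreeLeAt_of_control_of_bound {s : ℕ}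
    (hC : AdditiveControlOnTreeAt p κ 𝔭 γ ι P)
    (hB : ∀ n : ℕ, XAc.HasCharValuationAt (W.baseChange K) p κ 𝔭 ∅ γ n →
      2 * X11b.padicLogOrd W p ι P ≤ (n : ℤ) + 2 * (s : ℤ)) :
    AdditiveIMCLowerBDPOnTreeLeAt p κ 𝔭 γ ι s P := by
  obtain ⟨n, hn⟩ := exists_hasCharValuationAt_of_control hC
  exact ⟨n, hn, hB n hn⟩

end Pointwise

/-! ## §3 Class level, on the registered BC3 skeleton of item 19177 (stubs `stub_charTorsion`, `stub_divisibilityLe`) -/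

/-- **`stub_charTorsion` (item 19177, signature verbatim) ⟸ the control crux.** For every pair and Heegner datum of
the crux `GordTwoBranchIMC` (item 19177) and every anticyclotomic frame `(κ, γ, 𝔭)` with `𝔭 ∣ p` of
degree one, `X_ac^∅(E_K[p^∞])` is `Λ`-torsion with a characteristic generator of non-zero constant
term — GIVEN the sibling crux `AnticycControlAdditive` (item 19178) of the same route, whose socket
`AdditiveControlInputManinAt` carries the `HasCharValuationAt` witness on the larger cell
`SubSemistableTwist ⊇ SubGordTwo`. So the torsion/control half of `GordTwoBranchIMC` is not an
independent debt of the route. CONDITIONAL on `AnticycControlAdditive` (open). [folklore] -/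
theorem gordTwo_stub_charTorsion_of_anticycControlAdditive
    (hC : Theses.SchneiderFreeAdditiveX3.AnticycControlAdditive) :
    ∀ (W : WeierstrassCurve ℚ) [W.IsElliptic] [W.IsGloballyMinimal] (p : ℕ) [Fact p.Prime],
      W.analyticRank = 1 → p ≠ 2 → ClassX3 W p → Additive.SubGordTwo W p →
      ∀ (N : ℕ) [NeZero N] (K : Type) [Field K] [NumberField K]
        (Dt : ModularParametrizationData W N) (H : HeegnerDatum N (NumberField.discr K)) (ι : K →+* ℂ)
        (P : (W.baseChange K).toAffine.Point),
        W.analyticRank = 1 → Additive.N10.Locus W p → W.conductorNorm ℤ = N → IsImaginaryQuadratic K →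
        Odd (NumberField.discr K) → ¬ p ∣ Units.torsionOrder K → SatisfiesHeegnerHypothesis N K →
        (W.quadraticTwist (NumberField.discr K : ℚ)).entireLFunction 1 ≠ 0 →
        WeierstrassCurve.Affine.Point.map ι.toRatAlgHom P = heegnerPointComplex Dt H →
        ¬ IsOfFinAddOrder P →
        ∀ (κ : ZpExtension K p), κ.IsAnticyclotomic →
          ∀ (γ : Field.absoluteGaloisGroup K) [Fact (κ.IsTopGenerator γ)]
            (𝔭 : HeightOneSpectrum (𝓞 K)) (h𝔭 : ((p : ℕ) : 𝓞 K) ∈ 𝔭.asIdeal)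
            (he : 𝔭.asIdeal.ramificationIdx (𝓞 ℚ) = 1) (hf : 𝔭.asIdeal.inertiaDeg (𝓞 ℚ) = 1),
            ∃ n : ℕ, XAc.HasCharValuationAt (W.baseChange K) p κ 𝔭 ∅ γ n := by
  intro W _ _ p _ hr hp2 hX hS N _ K _ _ Dt H ι P hr' hloc hN hK hodd hunit hHe hL hP hnt κ hκ γ _ 𝔭
    h𝔭 he hf
  have hsst : Additive.SubSemistableTwist W p := Or.inr hS
  exact exists_hasCharValuationAt_of_control
    (hC W p hr hp2 hX hsst N K Dt H ι P hr' hloc hN hK hodd hunit hHe hL hP hnt κ hκ γ 𝔭 h𝔭 he hf)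

/-- **`GordTwoBranchIMC` ⇐ `AnticycControlAdditive` + `stub_divisibilityLe`.** With the control crux
(item 19178) supplying the `HasCharValuationAt` witness at every frame, the second registered stub of
item 19177 (signature verbatim, carried as a hypothesis: the Manin-robust bound
`2·ord_p log_{ω_E} P ≤ n + 2·v_p(c)` — Keller–Yin 2410.23241 Thm. 3.5.1 ∘ value at 𝟙, PRE) gives the
crux BY NAME. The (G-ord, `e = 2`) twin of door-c2's
`potMultBranchIMC_of_anticycControlAdditive_of_divisibilityLe`. CONDITIONAL on both hypotheses.
[cite: JetchevSkinnerWan2017, §7.4.1 (arXiv p. 30)] -/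
theorem gordTwoBranchIMC_of_anticycControlAdditive_of_divisibilityLe
    (hC : Theses.SchneiderFreeAdditiveX3.AnticycControlAdditive)
    (hdiv :
    ∀ (W : WeierstrassCurve ℚ) [W.IsElliptic] [W.IsGloballyMinimal] (p : ℕ) [Fact p.Prime],
      W.analyticRank = 1 → p ≠ 2 → ClassX3 W p → Additive.SubGordTwo W p →
      ∀ (N : ℕ) [NeZero N] (K : Type) [Field K] [NumberField K]
        (Dt : ModularParametrizationData W N) (H : HeegnerDatum N (NumberField.discr K)) (ι : K →+* ℂ)
        (P : (W.baseChange K).toAffine.Point),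
        W.analyticRank = 1 → Additive.N10.Locus W p → W.conductorNorm ℤ = N → IsImaginaryQuadratic K →
        Odd (NumberField.discr K) → ¬ p ∣ Units.torsionOrder K → SatisfiesHeegnerHypothesis N K →
        (W.quadraticTwist (NumberField.discr K : ℚ)).entireLFunction 1 ≠ 0 →
        WeierstrassCurve.Affine.Point.map ι.toRatAlgHom P = heegnerPointComplex Dt H →
        ¬ IsOfFinAddOrder P →
        ∀ (κ : ZpExtension K p), κ.IsAnticyclotomic →
          ∀ (γ : Field.absoluteGaloisGroup K) [Fact (κ.IsTopGenerator γ)]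
            (𝔭 : HeightOneSpectrum (𝓞 K)) (h𝔭 : ((p : ℕ) : 𝓞 K) ∈ 𝔭.asIdeal)
            (he : 𝔭.asIdeal.ramificationIdx (𝓞 ℚ) = 1) (hf : 𝔭.asIdeal.inertiaDeg (𝓞 ℚ) = 1),
            ∀ n : ℕ, XAc.HasCharValuationAt (W.baseChange K) p κ 𝔭 ∅ γ n →
              2 * X11b.padicLogOrd W p (embAt K p 𝔭 h𝔭 he hf) P ≤
                (n : ℤ) + 2 * (padicValNat p Dt.c.natAbs : ℤ)) :
    Theses.SchneiderFreeAdditiveX3.GordTwoBranchIMC := by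
  intro W _ _ p _ hr hp2 hX hS N _ K _ _ Dt H ι P hr' hloc hN hK hodd hunit hHe hL hP hnt κ hκ γ _ 𝔭
    h𝔭 he hf
  obtain ⟨n, hn⟩ := gordTwo_stub_charTorsion_of_anticycControlAdditive hC W p hr hp2 hX hS N K Dt H ι
    P hr' hloc hN hK hodd hunit hHe hL hP hnt κ hκ γ 𝔭 h𝔭 he hf
  exact ⟨n, hn, hdiv W p hr hp2 hX hS N K Dt H ι P hr' hloc hN hK hodd hunit hHe hL hP hnt κ hκ γ 𝔭 h𝔭
    he hf n hn⟩

/-- **`stub_divisibilityLe` (item 19177, signature verbatim) ⇐ a supply of HALVES.** If at every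
datum of the crux and every anticyclotomic frame `(κ, γ, 𝔭)` with `𝔭 ∣ p` of degree one there are
`L ∈ R₀⟦T⟧` and an integral cofactor `u ∈ R₀` with `Ch_Λ(X_ac^∅(E_K[p^∞]))·R₀⟦T⟧ ⊆ (L)` (branch main
conjecture ⊇; Keller–Yin 2410.23241 Thm. 3.5.1 for `L = 𝓛_ε`, PRE) and
`L(0) = u·(log_{ω_E} P / c)²`, `c = Dt.c` (value at 𝟙, intrinsic to the newform; the matching of
normalisations at `p² ∣ N` is NOT in print), then the registered divisibility stub holds. This is
the receptacle through which a typed/landed pair (branch IMC, value formula) closes the stub.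
[cite: Castella2018, §5 (5.1)–(5.3) (arXiv:1704.06608 p. 12) (the assembly, as an inequality)] -/
theorem gordTwo_stub_divisibilityLe_of_halves
    (hH :
    ∀ (W : WeierstrassCurve ℚ) [W.IsElliptic] [W.IsGloballyMinimal] (p : ℕ) [Fact p.Prime],
      W.analyticRank = 1 → p ≠ 2 → ClassX3 W p → Additive.SubGordTwo W p →
      ∀ (N : ℕ) [NeZero N] (K : Type) [Field K] [NumberField K]
        (Dt : ModularParametrizationData W N) (H : HeegnerDatum N (NumberField.discr K)) (ι : K →+* ℂ)
        (P : (W.baseChange K).toAffine.Point),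
        W.analyticRank = 1 → Additive.N10.Locus W p → W.conductorNorm ℤ = N → IsImaginaryQuadratic K →
        Odd (NumberField.discr K) → ¬ p ∣ Units.torsionOrder K → SatisfiesHeegnerHypothesis N K →
        (W.quadraticTwist (NumberField.discr K : ℚ)).entireLFunction 1 ≠ 0 →
        WeierstrassCurve.Affine.Point.map ι.toRatAlgHom P = heegnerPointComplex Dt H →
        ¬ IsOfFinAddOrder P →
        ∀ (κ : ZpExtension K p), κ.IsAnticyclotomic →
          ∀ (γ : Field.absoluteGaloisGroup K) [Fact (κ.IsTopGenerator γ)]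
            (𝔭 : HeightOneSpectrum (𝓞 K)) (h𝔭 : ((p : ℕ) : 𝓞 K) ∈ 𝔭.asIdeal)
            (he : 𝔭.asIdeal.ramificationIdx (𝓞 ℚ) = 1) (hf : 𝔭.asIdeal.inertiaDeg (𝓞 ℚ) = 1),
            ∃ (L : UnrSeries p) (u : unrIntegers p),
              (XAc.charIdeal (W.baseChange K) p κ 𝔭 ∅ γ).map (PowerSeries.map (toUnr p)) ≤
                Ideal.span {L} ∧
              L.HasValueAt 0 (((u : unrIntegers p) : ℂ_[p]) *
                (algebraMap ℚ_[p] ℂ_[p]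
                  (logOmega W p (embAt K p 𝔭 h𝔭 he hf) P / (Dt.c : ℚ_[p]))) ^ 2)) :
    ∀ (W : WeierstrassCurve ℚ) [W.IsElliptic] [W.IsGloballyMinimal] (p : ℕ) [Fact p.Prime],
      W.analyticRank = 1 → p ≠ 2 → ClassX3 W p → Additive.SubGordTwo W p →
      ∀ (N : ℕ) [NeZero N] (K : Type) [Field K] [NumberField K]
        (Dt : ModularParametrizationData W N) (H : HeegnerDatum N (NumberField.discr K)) (ι : K →+* ℂ)
        (P : (W.baseChange K).toAffine.Point),
        W.analyticRank = 1 → Additive.N10.Locus W p → W.conductorNorm ℤ = N → IsImaginaryQuadratic K →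
        Odd (NumberField.discr K) → ¬ p ∣ Units.torsionOrder K → SatisfiesHeegnerHypothesis N K →
        (W.quadraticTwist (NumberField.discr K : ℚ)).entireLFunction 1 ≠ 0 →
        WeierstrassCurve.Affine.Point.map ι.toRatAlgHom P = heegnerPointComplex Dt H →
        ¬ IsOfFinAddOrder P →
        ∀ (κ : ZpExtension K p), κ.IsAnticyclotomic →
          ∀ (γ : Field.absoluteGaloisGroup K) [Fact (κ.IsTopGenerator γ)]
            (𝔭 : HeightOneSpectrum (𝓞 K)) (h𝔭 : ((p : ℕ) : 𝓞 K) ∈ 𝔭.asIdeal)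
            (he : 𝔭.asIdeal.ramificationIdx (𝓞 ℚ) = 1) (hf : 𝔭.asIdeal.inertiaDeg (𝓞 ℚ) = 1),
            ∀ n : ℕ, XAc.HasCharValuationAt (W.baseChange K) p κ 𝔭 ∅ γ n →
              2 * X11b.padicLogOrd W p (embAt K p 𝔭 h𝔭 he hf) P ≤
                (n : ℤ) + 2 * (padicValNat p Dt.c.natAbs : ℤ) := by
  intro W _ _ p _ hr hp2 hX hS N _ K _ _ Dt H ι P hr' hloc hN hK hodd hunit hHe hL hP hnt κ hκ γ _ 𝔭
    h𝔭 he hf n hn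
  obtain ⟨L, u, h3, h2⟩ := hH W p hr hp2 hX hS N K Dt H ι P hr' hloc hN hK hodd hunit hHe hL hP hnt κ
    hκ γ 𝔭 h𝔭 he hf
  exact divisibilityLe_of_value_of_dvd hn h3 u Dt.c h2

end Summit.BirchSwinnertonDyer.BirchSwinnertonDyer.Theorems.SchneiderFree

end
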